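import Mathlib.Analysis.SpecialFunctions.Pow.Continuity
import Mathlib.Analysis.SpecialFunctions.Log.Basic
import Summits.CriticalPhenomena.PercolationContinuityZ3.Theorems.PercNearOneGluingNoHeavyLowerTailSunflowerLSMSuperadditive
import Summits.CriticalPhenomena.PercolationContinuityZ3.Theorems.PercNearOneGluingNoHeavyLowerTailSunflowerGradedSafe

/-!
# `NoHeavyLowerTail` (crux stmt-CriticalPhenomena-4575), abstract sunflower cubic: GRADED SAFETY FROM LOG-SUPERMODULARITY

Support file (seat `prim-ineq-prove-1` gen 35; `--supports stmt-CriticalPhenomena-4575`).  No `sorry`, no named facts.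
Memo: run/shared/lean/prim/prim-ineq-prove-1/FINDING-LSM-prove1-g35.md §1–§3 (Theorem C).

SETTING (as `…SunflowerGradedSafe`).  `μ = prodBernoulli p`, a block `a`, an up-set `A` determined by `a`, and a finite family `𝒯`
of "bad" subsets of the block (`a ∖ C ∉ A` for `C ∈ 𝒯`) such that every bad missing set `T ⊆ a` contains a member of `𝒯`
(e.g. the minimal transversals = the blocker of `A`).  For `𝒰 ⊆ 𝒯`,
`famIn p a 𝒯 𝒰 = P(every member of 𝒯 inside the missing set belongs to 𝒰) = μ(ω meets every C ∈ 𝒯 ∖ 𝒰)` (the hitting function).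
* **`gsafe_of_lsm`** (THEOREM C of the memo): if `famIn p a 𝒯` is LOG-SUPERMODULAR on the subsets of `𝒯`, then `A` is GRADEDLY SAFE
  (`SafeCalc.GSafe p a A`), hence safe (`safe_of_gsafe`) with all the rows of `…SunflowerSafeCalculus`.
PROOF.  Min-type reduction with integer ranks: for feasible `G i` put `ρ = log (G i C) / log c ∈ [0,1]`, `κ = min ⌊(N+n)ρ⌋ N`,
`q = c^{1/(N+n)}`; then `G i T ≤ q^{max_{C ⊆ T} κ_iC}`, the columns satisfy `∑_i κ_iC ≥ (n−1)N`, and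
`BEx p a (q^{maxRank κ_i}) = LSM.Phi q (famInSub p a 𝒯) κ_i` (geometric tails); `LSM.prod_Phi_le` (Theorem A + telescoping) gives
`∏ BEx (G i) ≤ (μA + (1−μA) c^{N/(N+n)})^{n−1}` for every `N`, and `N → ∞` concludes.
-/

noncomputable section

namespace Summit.CriticalPhenomena.PercolationContinuityZ3.Theorems.SunflowerPartition

namespace SafeCalc

open MeasureTheory Finset Filter Topology
open Literature.Probability.LatticeModels Literature.Probability.Percolation
open TwoGenCore (wmiss)

variable {ι : Type*} [DecidableEq ι] (p : ι → unitInterval) (a : Finset ι)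

/-! ## The family functional `famIn` and max-ranks -/

/-- `famIn p a 𝒯 𝒰`: the probability that every member of `𝒯` contained in the missing part of the block lies in `𝒰`
(equivalently: that `ω` meets every member of `𝒯 ∖ 𝒰` — the hitting function). [this work] -/
def famIn (𝒯 𝒰 : Finset (Finset ι)) : ℝ :=
  BEx p a (fun T => if ∀ C ∈ 𝒯, C ⊆ T → C ∈ 𝒰 then 1 else 0)

/-- The largest rank among the members of `𝒯` inside `T` (`0` if there is none). [this work] -/
def maxRank (𝒯 : Finset (Finset ι)) (κ : ↥𝒯 → ℕ) (T : Finset ι) : ℕ :=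
  (univ.filter fun C : ↥𝒯 => (C : Finset ι) ⊆ T).sup κ

/-- `famIn` is nonnegative. [this work] -/
theorem famIn_nonneg (𝒯 𝒰 : Finset (Finset ι)) : 0 ≤ famIn p a 𝒯 𝒰 :=
  sum_nonneg fun T _ => mul_nonneg (wmiss_nonneg p a T) (by dsimp only; split_ifs <;> norm_num)

/-- `famIn` is at most one. [this work] -/
theorem famIn_le_one (𝒯 𝒰 : Finset (Finset ι)) : famIn p a 𝒯 𝒰 ≤ 1 := by
  unfold famIn
  calc BEx p a (fun T => if ∀ C ∈ 𝒯, C ⊆ T → C ∈ 𝒰 then (1 : ℝ) else 0) ≤ BEx p a (fun _ => 1) :=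
        BEx_mono p a fun T _ => by split_ifs <;> norm_num
    _ = 1 := BEx_const p a 1

/-- `famIn` is monotone in the allowed family. [this work] -/
theorem famIn_mono (𝒯 : Finset (Finset ι)) {𝒰 𝒱 : Finset (Finset ι)} (h : 𝒰 ⊆ 𝒱) :
    famIn p a 𝒯 𝒰 ≤ famIn p a 𝒯 𝒱 := by
  unfold famIn
  refine BEx_mono p a fun T _ => ?_
  split_ifs with h1 h2
  exacts [le_rfl, absurd (fun C hC hCT => h (h1 C hC hCT)) h2, by norm_num, le_rfl]

/-- Allowing every member gives probability one. [this work] -/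
theorem famIn_self (𝒯 : Finset (Finset ι)) : famIn p a 𝒯 𝒯 = 1 := by
  unfold famIn
  have : (fun T : Finset ι => if ∀ C ∈ 𝒯, C ⊆ T → C ∈ 𝒯 then (1 : ℝ) else 0) = fun _ => 1 := by
    funext T; rw [if_pos fun C hC _ => hC]
  rw [this, BEx_const]

/-- With no member of `𝒯` allowed, `famIn` is the probability that the missing set is good. [this work] -/
theorem famIn_empty [Fintype ι] {A : Set (Set ι)} (hd : DeterminedBy A (↑a : Set ι)) (𝒯 : Finset (Finset ι))
    (hbad : ∀ C ∈ 𝒯, ∀ T, T ⊆ a → C ⊆ T → ((a \ T : Finset ι) : Set ι) ∉ A)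
    (hcov : ∀ T, T ⊆ a → ((a \ T : Finset ι) : Set ι) ∉ A → ∃ C ∈ 𝒯, C ⊆ T) :
    famIn p a 𝒯 ∅ = (prodBernoulli p).real A := by
  classical
  rw [← BEx_indicator_eq_real p hd]
  unfold famIn BEx
  refine sum_congr rfl fun T hT => ?_
  rw [mem_powerset] at hT
  congr 1
  dsimp only
  by_cases hA : ((a \ T : Finset ι) : Set ι) ∈ A
  · rw [if_pos hA, if_pos]
    intro C hC hCT
    exact absurd hA (hbad C hC T hT hCT)
  · rw [if_neg hA, if_neg]
    intro h
    obtain ⟨C, hC, hCT⟩ := hcov T hT hA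
    exact absurd (h C hC hCT) (notMem_empty _)

/-- The functional on ranked sub-families of `𝒯` (sub-families as finsets of the subtype). [this work] -/
def famInSub (𝒯 : Finset (Finset ι)) (𝒰 : Finset ↥𝒯) : ℝ :=
  famIn p a 𝒯 (𝒰.map (Function.Embedding.subtype _))

/-- Level sets of ranks versus max-ranks. [this work] -/
theorem famInSub_lev (𝒯 : Finset (Finset ι)) (κ : ↥𝒯 → ℕ) (g : ℕ) :
    famInSub p a 𝒯 (LSM.lev κ g) = BEx p a (fun T => if maxRank 𝒯 κ T ≤ g then 1 else 0) := by
  unfold famInSub famIn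
  congr 1; funext T
  have : (∀ C ∈ 𝒯, C ⊆ T → C ∈ (LSM.lev κ g).map (Function.Embedding.subtype _)) ↔ maxRank 𝒯 κ T ≤ g := by
    unfold maxRank
    rw [Finset.sup_le_iff]
    constructor
    · intro h C hC
      rw [mem_filter] at hC
      have h1 := h C C.2 hC.2
      rw [Finset.mem_map] at h1
      obtain ⟨C', hC', hCC'⟩ := h1
      have heq : C' = C := Subtype.ext (by simpa using hCC')
      unfold LSM.lev at hC'
      rw [mem_filter] at hC'
      rw [← heq]; exact hC'.2
    · intro h C hC hCT
      rw [Finset.mem_map]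
      refine ⟨⟨C, hC⟩, ?_, rfl⟩
      unfold LSM.lev
      rw [mem_filter]
      exact ⟨mem_univ _, h ⟨C, hC⟩ (by rw [mem_filter]; exact ⟨mem_univ _, hCT⟩)⟩
  simp only [this]

/-- **Geometric tails**: the block expectation of `q^{maxRank}` is the functional `LSM.Phi` of `famInSub`. [this work] -/
theorem BEx_pow_maxRank {q : ℝ} (hq0 : 0 ≤ q) (hq1 : q < 1) (𝒯 : Finset (Finset ι)) (κ : ↥𝒯 → ℕ) :
    BEx p a (fun T => q ^ maxRank 𝒯 κ T) = LSM.Phi q (famInSub p a 𝒯) κ := by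
  unfold LSM.Phi
  simp only [famInSub_lev]
  unfold BEx
  have hsw : ∀ g : ℕ, (1 - q) * q ^ g * ∑ T ∈ a.powerset, wmiss p a T * (if maxRank 𝒯 κ T ≤ g then (1 : ℝ) else 0) =
      ∑ T ∈ a.powerset, wmiss p a T * ((1 - q) * q ^ g * (if maxRank 𝒯 κ T ≤ g then (1 : ℝ) else 0)) := by
    intro g; rw [mul_sum]; exact sum_congr rfl fun T _ => by ring
  rw [tsum_congr hsw]
  have hs : ∀ T ∈ a.powerset, Summable fun g : ℕ =>
      wmiss p a T * ((1 - q) * q ^ g * (if maxRank 𝒯 κ T ≤ g then (1 : ℝ) else 0)) := by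
    intro T _
    refine Summable.mul_left _ (Summable.of_nonneg_of_le (fun g => ?_) (fun g => ?_)
      ((summable_geometric_of_lt_one hq0 hq1).mul_left (1 - q)))
    · exact mul_nonneg (mul_nonneg (by linarith) (pow_nonneg hq0 g)) (by split_ifs <;> norm_num)
    · have h2 : 0 ≤ (1 - q) * q ^ g := mul_nonneg (by linarith) (pow_nonneg hq0 g)
      calc (1 - q) * q ^ g * (if maxRank 𝒯 κ T ≤ g then (1 : ℝ) else 0) ≤ (1 - q) * q ^ g * 1 :=
            mul_le_mul_of_nonneg_left (by split_ifs <;> norm_num) h2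
        _ = (1 - q) * q ^ g := mul_one _
  rw [Summable.tsum_finsetSum hs]
  refine sum_congr rfl fun T _ => ?_
  rw [tsum_mul_left, LSM.tsum_geometric_indicator hq0 hq1]

/-! ## Integer ranks from a feasible configuration -/

section ranks

variable {n : ℕ} {c : ℝ} (hc : 0 < c) (hc1 : c < 1) (N : ℕ)

/-- The real exponent `ρ = log x / log c` of `x ∈ [c,1]` (so that `c^ρ = x`). [this work] -/
def rho (c x : ℝ) : ℝ := Real.log x / Real.log c

/-- The integer rank `min ⌊(N+n) ρ⌋ N`. [this work] -/
def rank (c : ℝ) (N n : ℕ) (x : ℝ) : ℕ := min ⌊((N + n : ℕ) : ℝ) * rho c x⌋₊ N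

omit hc hc1 in
/-- Ranks never exceed `N`. [this work] -/
theorem rank_le : ∀ x : ℝ, rank c N n x ≤ N := fun _ => min_le_right _ _

include hc hc1

/-- `log c < 0` for `c ∈ (0,1)`. [this work] -/
theorem log_c_neg : Real.log c < 0 := Real.log_neg hc hc1

/-- The exponent of `x ∈ (0,1]` is nonnegative. [this work] -/
theorem rho_nonneg {x : ℝ} (hx : 0 < x) (hx1 : x ≤ 1) : 0 ≤ rho c x :=
  div_nonneg_of_nonpos (Real.log_nonpos hx.le hx1) (log_c_neg hc hc1).le

/-- The exponent of `x ≥ c` is at most one. [this work] -/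
theorem rho_le_one {x : ℝ} (hx : c ≤ x) : rho c x ≤ 1 := by
  unfold rho
  rw [div_le_one_of_neg (log_c_neg hc hc1)]
  exact Real.log_le_log hc hx

/-- `c ^ rho c x = x`. [this work] -/
theorem rpow_rho {x : ℝ} (hx : 0 < x) : c ^ rho c x = x := by
  unfold rho
  rw [Real.rpow_def_of_pos hc, mul_div_cancel₀ _ (log_c_neg hc hc1).ne, Real.exp_log hx]

/-- `x ≤ q ^ rank x` with `q = c^{1/(N+n)}`: rounding the exponent down only increases the power. [this work] -/
theorem le_q_pow_rank (hn : 1 ≤ N + n) {x : ℝ} (hx : 0 < x) (hx1 : x ≤ 1) :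
    x ≤ (c ^ (1 / ((N + n : ℕ) : ℝ))) ^ rank c N n x := by
  have hN : (0 : ℝ) < ((N + n : ℕ) : ℝ) := by exact_mod_cast hn
  rw [← Real.rpow_natCast, ← Real.rpow_mul hc.le]
  conv_lhs => rw [← rpow_rho hc hc1 hx]
  refine Real.rpow_le_rpow_of_exponent_ge hc hc1.le ?_
  rw [one_div_mul_eq_div, div_le_iff₀ hN]
  have h1 : (rank c N n x : ℝ) ≤ ⌊((N + n : ℕ) : ℝ) * rho c x⌋₊ := by
    unfold rank; exact_mod_cast min_le_left _ _
  refine h1.trans ?_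
  have hr : 0 ≤ ((N + n : ℕ) : ℝ) * rho c x := mul_nonneg hN.le (rho_nonneg hc hc1 hx hx1)
  exact (Nat.floor_le hr).trans (le_of_eq (mul_comm _ _))

/-- **Column condition after rounding.**  If `∑_i ρ_i ≥ n − 1` with `ρ_i ∈ [0,1]` then `∑_i min ⌊(N+n)ρ_i⌋ N ≥ (n−1)N`. [this work] -/
theorem sum_rank_ge (x : Fin n → ℝ) (hx0 : ∀ i, 0 < x i) (hxc : ∀ i, c ≤ x i) (hx1 : ∀ i, x i ≤ 1)
    (hprod : ∏ i, x i ≤ c ^ (n - 1)) : (n - 1) * N ≤ ∑ i, rank c N n (x i) := by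
  -- exponents
  have hρ0 : ∀ i, 0 ≤ rho c (x i) := fun i => rho_nonneg hc hc1 (hx0 i) (hx1 i)
  have hρ1 : ∀ i, rho c (x i) ≤ 1 := fun i => rho_le_one hc hc1 (hxc i)
  have hρsum : ((n - 1 : ℕ) : ℝ) ≤ ∑ i, rho c (x i) := by
    have hlog : ∑ i, Real.log (x i) ≤ ((n - 1 : ℕ) : ℝ) * Real.log c := by
      rw [← Real.log_prod (s := univ) (f := x) (fun i _ => (hx0 i).ne'), ← Real.log_pow]
      exact Real.log_le_log (prod_pos fun i _ => hx0 i) hprod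
    have : ∑ i, rho c (x i) = (∑ i, Real.log (x i)) / Real.log c := by
      unfold rho; rw [sum_div]
    rw [this, le_div_iff_of_neg (log_c_neg hc hc1)]
    linarith
  -- per-player deficit e_i := N - rank_i
  set M : ℕ := N + n with hM
  -- key real inequality for an uncapped player: floor ≥ M ρ - 1
  have hfloor : ∀ i, (M : ℝ) * rho c (x i) - 1 ≤ (⌊(M : ℝ) * rho c (x i)⌋₊ : ℕ) := fun i =>
    (Nat.sub_one_lt_floor _).le
  -- Case analysis on the number of capped players
  set P := univ.filter fun i : Fin n => rank c N n (x i) < N with hP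
  have hsplit : ∑ i, rank c N n (x i) = ∑ i ∈ P, rank c N n (x i) + ∑ i ∈ Pᶜ, rank c N n (x i) :=
    (sum_add_sum_compl P _).symm
  have hcapped : ∀ i ∈ Pᶜ, rank c N n (x i) = N := by
    intro i hi
    simp only [mem_compl, hP, mem_filter, mem_univ, true_and, not_lt] at hi
    have := rank_le N (n := n) (c := c) (x i)
    omega
  have hPc : ∑ i ∈ Pᶜ, rank c N n (x i) = Pᶜ.card * N := by
    rw [sum_congr rfl hcapped, sum_const, smul_eq_mul]
  rcases Nat.lt_or_ge Pᶜ.card (n - 1) with hsmall | hbig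
  · -- fewer than n-1 capped players: at least two uncapped; use the real bound
    have hPcard : P.card + Pᶜ.card = n := by
      rw [Finset.card_compl, Fintype.card_fin]
      have := card_le_univ P; rw [Fintype.card_fin] at this; omega
    have hP2 : 2 ≤ P.card := by omega
    -- for i ∈ P: rank = floor(M ρ) ≥ M ρ - 1
    have hPrank : ∀ i ∈ P, (M : ℝ) * rho c (x i) - 1 ≤ (rank c N n (x i) : ℝ) := by
      intro i hi
      rw [hP, mem_filter] at hi
      have hlt := hi.2
      unfold rank at hlt ⊢
      have : ⌊(M : ℝ) * rho c (x i)⌋₊ < N := by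
        by_contra hge; push Not at hge; rw [min_eq_right hge] at hlt; exact lt_irrefl _ hlt
      rw [min_eq_left this.le]
      exact hfloor i
    -- sum over P of ρ ≥ (n-1) - |Pᶜ|
    have hρP : ((n - 1 : ℕ) : ℝ) - (Pᶜ.card : ℝ) ≤ ∑ i ∈ P, rho c (x i) := by
      have h1 : ∑ i, rho c (x i) = ∑ i ∈ P, rho c (x i) + ∑ i ∈ Pᶜ, rho c (x i) := (sum_add_sum_compl P _).symm
      have h2 : ∑ i ∈ Pᶜ, rho c (x i) ≤ Pᶜ.card := by
        have := sum_le_sum fun i (_ : i ∈ Pᶜ) => hρ1 i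
        rw [sum_const, nsmul_eq_mul, mul_one] at this; exact this
      linarith
    have hsumP : (M : ℝ) * (((n - 1 : ℕ) : ℝ) - Pᶜ.card) - P.card ≤ ∑ i ∈ P, (rank c N n (x i) : ℝ) := by
      have h1 := sum_le_sum hPrank
      rw [sum_sub_distrib, sum_const, nsmul_eq_mul, mul_one, ← mul_sum] at h1
      have hMpos : (0 : ℝ) ≤ M := Nat.cast_nonneg _
      nlinarith [mul_le_mul_of_nonneg_left hρP hMpos]
    -- conclude in ℝ
    have hgoal : (((n - 1) * N : ℕ) : ℝ) ≤ ((∑ i, rank c N n (x i) : ℕ) : ℝ) := by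
      rw [hsplit, hPc]
      push_cast
      have hn1 : ((n - 1 : ℕ) : ℝ) = (n : ℝ) - 1 := by
        have : 1 ≤ n := by omega
        rw [Nat.cast_sub this, Nat.cast_one]
      rw [hn1] at hsumP hρP
      have hMR : (M : ℝ) = N + n := by rw [hM]; push_cast; ring
      have hPcR : (Pᶜ.card : ℝ) = n - P.card := by
        have : (P.card : ℝ) + Pᶜ.card = n := by exact_mod_cast hPcard
        linarith
      rw [hMR, hPcR] at hsumP
      have hP2R : (2 : ℝ) ≤ P.card := by exact_mod_cast hP2
      have hn1' : ((n - 1 : ℕ) : ℝ) = (n : ℝ) - 1 := hn1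
      rw [hn1', hPcR]
      have hPle : (P.card : ℝ) ≤ n := by exact_mod_cast (hPcard ▸ Nat.le_add_right P.card Pᶜ.card)
      have hNR : (0 : ℝ) ≤ N := Nat.cast_nonneg _
      nlinarith [hsumP, hP2R, hPle, hNR, mul_nonneg hNR (sub_nonneg.2 hPle)]
    exact_mod_cast hgoal
  · -- at least n-1 capped players
    calc (n - 1) * N ≤ Pᶜ.card * N := Nat.mul_le_mul_right _ hbig
      _ = ∑ i ∈ Pᶜ, rank c N n (x i) := hPc.symm
      _ ≤ ∑ i, rank c N n (x i) := sum_le_sum_of_subset_of_nonneg (subset_univ _) fun _ _ _ => Nat.zero_le _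

end ranks

/-! ## Theorem C -/

/-- **Graded safety from log-supermodularity** (THEOREM C of the memo).  Let `A` be an up-set determined by the block `a`,
`𝒯` a finite family of bad subsets of the block such that every bad missing set contains a member of `𝒯`, and suppose the
family functional `famIn p a 𝒯` (the hitting function of `𝒯`) is log-supermodular.  Then `A` is gradedly safe. [this work] -/
theorem gsafe_of_lsm [Fintype ι] {A : Set (Set ι)} (hd : DeterminedBy A (↑a : Set ι)) (hu : IsUpperSet A)
    (𝒯 : Finset (Finset ι)) (h𝒯a : ∀ C ∈ 𝒯, C ⊆ a) (hbad : ∀ C ∈ 𝒯, ((a \ C : Finset ι) : Set ι) ∉ A)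
    (hcov : ∀ T, T ⊆ a → ((a \ T : Finset ι) : Set ι) ∉ A → ∃ C ∈ 𝒯, C ⊆ T)
    (hlsm : ∀ 𝒰 𝒱 : Finset (Finset ι),
      famIn p a 𝒯 𝒰 * famIn p a 𝒯 𝒱 ≤ famIn p a 𝒯 (𝒰 ∪ 𝒱) * famIn p a 𝒯 (𝒰 ∩ 𝒱)) :
    GSafe p a A := by
  classical
  intro n c hc hc1 G hanti hle1 hge hgood hbadG
  set μA := (prodBernoulli p).real A with hμA
  have hμ0 : 0 ≤ μA := measureReal_nonneg
  have hμ1 : μA ≤ 1 := measureReal_le_one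
  -- badness is inherited by supersets inside the block
  have hbad' : ∀ C ∈ 𝒯, ∀ T, T ⊆ a → C ⊆ T → ((a \ T : Finset ι) : Set ι) ∉ A := by
    intro C hC T hT hCT hTA
    refine hbad C hC (hu ?_ hTA)
    intro e he
    rw [Finset.mem_coe, Finset.mem_sdiff] at he ⊢
    exact ⟨he.1, fun h => he.2 (hCT h)⟩
  rcases Nat.eq_zero_or_pos n with hn0 | hnpos
  · subst hn0; simp only [univ_eq_empty, prod_empty, Nat.zero_sub, pow_zero]; exact le_rfl
  rcases eq_or_lt_of_le hc1 with hceq | hclt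
  · -- c = 1: all G i ≡ 1
    have hG1 : ∀ i, BEx p a (G i) = 1 := by
      intro i
      have : BEx p a (G i) = BEx p a (fun _ => 1) :=
        Finset.sum_congr rfl fun T hT => by
          rw [mem_powerset] at hT
          rw [le_antisymm (hle1 i T hT) (hceq ▸ hge i T hT)]
      rw [this, BEx_const]
    rw [prod_congr rfl fun i _ => hG1 i, prod_const_one, hceq]
    have : μA + (1 - μA) * 1 = 1 := by ring
    rw [this, one_pow]
  -- main case: 0 < c < 1, n ≥ 1.  Bound for every N, then N → ∞.
  have key : ∀ N : ℕ, ∏ i, BEx p a (G i) ≤ (μA + (1 - μA) * c ^ ((N : ℝ) / ((N + n : ℕ) : ℝ))) ^ (n - 1) := by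
    intro N
    set M : ℕ := N + n with hM
    have hM1 : 1 ≤ N + n := by omega
    have hMR : (0 : ℝ) < ((N + n : ℕ) : ℝ) := by exact_mod_cast hM1
    set q : ℝ := c ^ (1 / ((N + n : ℕ) : ℝ)) with hq
    have hq0 : 0 ≤ q := Real.rpow_nonneg hc.le _
    have hq1 : q < 1 := Real.rpow_lt_one hc.le hclt (by positivity)
    -- ranks
    let κ : Fin n → ↥𝒯 → ℕ := fun i C => rank c N n (G i C)
    have hκN : ∀ i C, κ i C ≤ N := fun i C => rank_le N _
    have hGpos : ∀ i T, T ⊆ a → 0 < G i T := fun i T hT => hc.trans_le (hge i T hT)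
    -- column condition
    have hcol : ∀ C : ↥𝒯, ((univ : Finset (Fin n)).card - 1) * N ≤ ∑ i, κ i C := by
      intro C
      rw [card_univ, Fintype.card_fin]
      exact sum_rank_ge hc hclt N (fun i => G i C) (fun i => hGpos i C (h𝒯a C C.2)) (fun i => hge i C (h𝒯a C C.2))
        (fun i => hle1 i C (h𝒯a C C.2)) (hbadG C (h𝒯a C C.2) (hbad C C.2))
    -- the min-type majorant
    have hmaj : ∀ i T, T ⊆ a → G i T ≤ q ^ maxRank 𝒯 (κ i) T := by
      intro i T hT
      by_cases hne : (univ.filter fun C : ↥𝒯 => (C : Finset ι) ⊆ T).Nonempty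
      · obtain ⟨C, hC, hCeq⟩ := exists_mem_eq_sup _ hne (κ i)
        rw [mem_filter] at hC
        unfold maxRank; rw [hCeq]
        exact (hanti i _ _ hC.2 hT).trans (le_q_pow_rank hc hclt N hM1 (hGpos i C (h𝒯a C C.2)) (hle1 i C (h𝒯a C C.2)))
      · rw [Finset.not_nonempty_iff_eq_empty] at hne
        unfold maxRank; rw [hne, sup_empty, bot_eq_zero, pow_zero]
        exact hle1 i T hT
    -- f = famInSub is nonnegative, monotone, log-supermodular, with f univ = 1 and f ∅ = μA
    have hf0 : ∀ 𝒰 : Finset ↥𝒯, 0 ≤ famInSub p a 𝒯 𝒰 := fun 𝒰 => famIn_nonneg p a 𝒯 _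
    have hfm : ∀ 𝒰 𝒱 : Finset ↥𝒯, 𝒰 ⊆ 𝒱 → famInSub p a 𝒯 𝒰 ≤ famInSub p a 𝒯 𝒱 :=
      fun 𝒰 𝒱 h => famIn_mono p a 𝒯 (Finset.map_subset_map.2 h)
    have hfl : ∀ 𝒰 𝒱 : Finset ↥𝒯, famInSub p a 𝒯 𝒰 * famInSub p a 𝒯 𝒱 ≤
        famInSub p a 𝒯 (𝒰 ∪ 𝒱) * famInSub p a 𝒯 (𝒰 ∩ 𝒱) := by
      intro 𝒰 𝒱
      unfold famInSub
      rw [Finset.map_union, Finset.map_inter]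
      exact hlsm _ _
    have hfuniv : famInSub p a 𝒯 univ = 1 := by
      refine le_antisymm (famIn_le_one p a _ _) ?_
      unfold famInSub
      rw [← famIn_self p a 𝒯]
      exact famIn_mono p a 𝒯 fun C hC => Finset.mem_map.2 ⟨⟨C, hC⟩, mem_univ _, rfl⟩
    have hfempty : famInSub p a 𝒯 ∅ = μA := by
      unfold famInSub; rw [Finset.map_empty]; exact famIn_empty p a hd 𝒯 hbad' hcov
    have step1 : ∏ i, BEx p a (G i) ≤ ∏ i, LSM.Phi q (famInSub p a 𝒯) (κ i) := by
      refine prod_le_prod (fun i _ => ?_) (fun i _ => ?_)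
      · unfold BEx; exact sum_nonneg fun T hT => mul_nonneg (wmiss_nonneg p a T) (hGpos i T (mem_powerset.1 hT)).le
      · rw [← BEx_pow_maxRank p a hq0 hq1 𝒯 (κ i)]
        exact BEx_mono p a fun T hT => hmaj i T hT
    have step2 := LSM.prod_Phi_le hq0 hq1 hf0 hfm hfl κ N hκN univ
      (univ_nonempty_iff.2 ⟨⟨0, hnpos⟩⟩) hcol
    rw [hfuniv, one_mul, card_univ, Fintype.card_fin, LSM.Phi_const hq0 hq1 (f := famInSub p a 𝒯) N,
      hfuniv, hfempty] at step2
    have hqN : q ^ N = c ^ ((N : ℝ) / ((N + n : ℕ) : ℝ)) := by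
      rw [hq, ← Real.rpow_natCast, ← Real.rpow_mul hc.le, one_div_mul_eq_div]
    refine step1.trans (step2.trans (le_of_eq ?_))
    rw [hqN]; ring
  -- N → ∞
  have hlim : Tendsto (fun N : ℕ => (μA + (1 - μA) * c ^ ((N : ℝ) / ((N + n : ℕ) : ℝ))) ^ (n - 1)) atTop
      (𝓝 ((μA + (1 - μA) * c ^ (1 : ℝ)) ^ (n - 1))) := by
    have h1 : Tendsto (fun N : ℕ => (N : ℝ) / ((N + n : ℕ) : ℝ)) atTop (𝓝 1) := by
      have := tendsto_natCast_div_add_atTop (n : ℝ)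
      refine this.congr fun N => ?_
      push_cast; rfl
    have h2 : Tendsto (fun N : ℕ => c ^ ((N : ℝ) / ((N + n : ℕ) : ℝ))) atTop (𝓝 (c ^ (1 : ℝ))) :=
      ((Real.continuous_const_rpow hc.ne').tendsto 1).comp h1
    exact ((tendsto_const_nhds.add (tendsto_const_nhds.mul h2)).pow (n - 1))
  rw [Real.rpow_one] at hlim
  exact ge_of_tendsto' hlim key

end SafeCalc

end Summit.CriticalPhenomena.PercolationContinuityZ3.Theorems.SunflowerPartition
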